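import Mathlib
import Summits.Ventures.PercRepro2.HCov
import Summits.Ventures.PercRepro2.A3Inactive
import Summits.Ventures.PercRepro2.EdgeCubic
import Summits.Ventures.PercRepro2.EdgeCubicAll
import Summits.Ventures.PercRepro2.RootEdgeBernSwap
import Summits.Ventures.PercRepro2.CPolarA3
import Summits.Ventures.PercRepro2.CPolarA3Marks
import Summits.Ventures.PercRepro2.PendantA3Pins
import Summits.Ventures.PercRepro2.PendantClusterPins
import Summits.Ventures.PercRepro2.PendantClusterMasses

/-!
# Row 2′CPOLAR at a PENDANT `a₃`-CLUSTER is a theorem wherever the attachment vertex is positively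
correlated with `o` in the union cluster — and the crux needs the Bernstein positivity only at the
NON-pendant-PA edges (blind cell PercRepro2, p5 g15; `proofs/P5-OEDGE.md` §17)

The contracted form of PendantA3Bern.lean: when `f = {z, u}` is the ONLY fractional edge touching the
mark-free pinned-open reach `K` of `a₃` (`z ∈ K`, `u ∉ K`), the twenty-four masses of `EdgeLine.B1` / `B2`
collapse almost surely onto the base vocabulary (PendantClusterMasses.lean), the polynomial identities
`B1Poly_pendant` / `B2Poly_pendant` and `slack_nonneg` of PendantA3Pins.lean apply verbatim, and

* **`B1_nonneg_cluster`**, **`B2_nonneg_cluster`**, **`HCov_cluster_of_cov_nonneg`**: given (HCOV) at both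
  pins, `P(PD_u) > 0` and `Cov_ν(U_o, U_u) ≥ 0`, `0 ≤ B1`, `0 ≤ B2` and (HCOV) at `p`;
* `PendantPA` records such an edge; **`HCov_of_bern_a3_nonpendant`** runs the induction of
  `CPolarA3.HCov_of_bern_a3_free` taking the pendant-PA edges by the theorem, and
  **`HCov_all_of_cpolarA3NP_all : CPolarA3NP_all R → HCov_all R`**: the crux from row 2′CPOLAR at the
  non-root, non-pendant-PA edges of the mark-free `a₃`-clusters — in graph language, at the edges of
  `a₃` in the contracted instances where either `a₃` has at least two fractional edges or its single
  fractional edge leads to a vertex negatively correlated with `o` in the union cluster.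
-/

namespace Summit.Ventures.PercRepro2

open UnionCluster CovForm CovForm.CPolarA3 PendantA3

namespace PendantCluster

section Main

variable {V : Type*} {E : Type*} [Fintype V] [DecidableEq V] [Fintype E] [DecidableEq E]
  {R : Type*} [Field R] [LinearOrder R] [IsStrictOrderedRing R]

open EdgeLine

/-- **`0 ≤ B1` at the single fractional boundary edge `f = {z, u}` of a mark-free pendant `a₃`-cluster**
(`z` in the reach, `u` outside), given (HCOV) at both pins, `P(PD_u) > 0` and the union-cluster
covariance `Cov_ν(U_o, U_u) ≥ 0` in its cleared form `P(Q)·P(PD_u, o ∈ U) ≤ P(Q, o ∈ U)·P(PD_u)`. -/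
theorem B1_nonneg_cluster (p : E → R) (hp : IsProbVec p) {ends : E → Sym2 V} {f : E}
    {o a₁ a₂ a₃ b z u : V} (hK : ∀ e ∈ fracEdges p, TouchesReach p ends a₃ e → e = f)
    (hf : ends f = s(z, u)) (hz : z ∈ pinnedReach p ends a₃) (hu : u ∉ pinnedReach p ends a₃)
    (hf1 : p f ≠ 1) (h1 : a₁ ∉ pinnedReach p ends a₃) (h2 : a₂ ∉ pinnedReach p ends a₃)
    (ho : o ∉ pinnedReach p ends a₃) (hb : b ∉ pinnedReach p ends a₃)
    (hD : 0 < prob p (PDEvent ends a₁ a₂ u))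
    (h₀ : HCov (Function.update p f 0) ends o a₁ a₂ a₃ b)
    (h₁ : HCov (Function.update p f 1) ends o a₁ a₂ a₃ b)
    (hcov : prob p (avoidAll ends a₂ {a₁}) * Do p ends o a₁ a₂ u ≤
      (prob p (avoidAll ends a₂ {a₁} ∩ connEvent ends a₁ o) +
        prob p (avoidAll ends a₂ {a₁} ∩ connEvent ends a₂ o)) * prob p (PDEvent ends a₁ a₂ u)) :
    0 ≤ B1 p ends o a₁ a₂ a₃ b f := by
  obtain ⟨hQ0, hD0, hDo0, hEQbo0, hEQb3_0, hEQb3o0, hEQo0, hEQ3_0, hEQ3o0, hPDb0, hPDbo0, hgap0⟩ :=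
    pins_zero_cluster p hK hf hz hu hf1 h1 h2 ho hb
  obtain ⟨hQ1, hD1, hDo1, hEQbo1, hEQb3_1, hEQb3o1, hEQo1, hEQ3_1, hEQ3o1, hPDb1, hPDbo1, hgap1⟩ :=
    pins_one_cluster p hK hf hz hu hf1 h1 h2 ho hb
  unfold HCov at h₀ h₁
  rw [Gc_eq_GcPoly] at h₀ h₁
  unfold B1
  rw [hQ0, hD0, hDo0, hEQbo0, hEQb3_0, hEQb3o0, hEQo0, hEQ3_0, hEQ3o0, hPDb0, hPDbo0, hgap0] at h₀
  rw [hQ1, hD1, hDo1, hEQbo1, hEQb3_1, hEQb3o1, hEQo1, hEQ3_1, hEQ3o1, hPDb1, hPDbo1, hgap1] at h₁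
  rw [hQ0, hD0, hDo0, hEQbo0, hEQb3_0, hEQb3o0, hEQo0, hEQ3_0, hEQ3o0, hPDb0, hPDbo0, hgap0, hQ1, hD1, hDo1, hEQbo1, hEQb3_1, hEQb3o1, hEQo1, hEQ3_1, hEQ3o1, hPDb1, hPDbo1, hgap1]
  have hQ : 0 ≤ prob p (avoidAll ends a₂ {a₁}) := prob_nonneg hp _
  have hQD : 0 < prob p (avoidAll ends a₂ {a₁}) * prob p (PDEvent ends a₁ a₂ u) := by
    have hle : prob p (PDEvent ends a₁ a₂ u) ≤ prob p (avoidAll ends a₂ {a₁}) := by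
      have := prob_PD_u_inter p ends a₁ a₂ u Set.univ
      simp only [Set.inter_univ] at this
      rw [this]
      linarith [prob_nonneg hp (avoidAll ends a₂ {a₁} ∩ connEvent ends a₂ u),
        prob_nonneg hp (avoidAll ends a₂ {a₁} ∩ connEvent ends a₁ u)]
    exact mul_pos (lt_of_lt_of_le hD hle) hD
  have hsl := slack_nonneg p hp ends a₁ a₂ u b
  have key := B1Poly_pendant (prob p (avoidAll ends a₂ {a₁})) (gap p ends a₁ a₂ b)
    (EQbo p ends o a₁ a₂ b) (EQo p ends o a₁ a₂)
    (prob p (avoidAll ends a₂ {a₁} ∩ connEvent ends a₁ o) +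
      prob p (avoidAll ends a₂ {a₁} ∩ connEvent ends a₂ o))
    (prob p (avoidAll ends a₂ {a₁} ∩ connEvent ends a₁ b) +
      prob p (avoidAll ends a₂ {a₁} ∩ connEvent ends a₂ b))
    (prob p (avoidAll ends a₂ {a₁} ∩ (connEvent ends a₁ o ∩ connEvent ends a₁ b)) +
      prob p (avoidAll ends a₂ {a₁} ∩ (connEvent ends a₂ o ∩ connEvent ends a₁ b)) +
      prob p (avoidAll ends a₂ {a₁} ∩ (connEvent ends a₁ o ∩ connEvent ends a₂ b)) +
      prob p (avoidAll ends a₂ {a₁} ∩ (connEvent ends a₂ o ∩ connEvent ends a₂ b)))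
    (prob p (PDEvent ends a₁ a₂ u)) (Do p ends o a₁ a₂ u) (EQb3 p ends a₁ a₂ u b)
    (EQb3o p ends o a₁ a₂ u b) (EQ3 p ends a₁ a₂ u) (EQ3o p ends o a₁ a₂ u)
    (PDb p ends a₁ a₂ u b) (PDbo p ends o a₁ a₂ u b)
  have hcov' : 0 ≤ (prob p (avoidAll ends a₂ {a₁} ∩ connEvent ends a₁ o) +
      prob p (avoidAll ends a₂ {a₁} ∩ connEvent ends a₂ o)) * prob p (PDEvent ends a₁ a₂ u) -
      prob p (avoidAll ends a₂ {a₁}) * Do p ends o a₁ a₂ u := by linarith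
  have hrhs : 0 ≤ prob p (avoidAll ends a₂ {a₁}) * prob p (PDEvent ends a₁ a₂ u) *
      B1Poly (prob p (avoidAll ends a₂ {a₁})) (prob p (avoidAll ends a₂ {a₁}))
        (prob p (avoidAll ends a₂ {a₁} ∩ connEvent ends a₁ o) +
          prob p (avoidAll ends a₂ {a₁} ∩ connEvent ends a₂ o))
        (EQbo p ends o a₁ a₂ b) 0 0 (EQo p ends o a₁ a₂) 0 0
        (prob p (avoidAll ends a₂ {a₁} ∩ connEvent ends a₁ b) +
          prob p (avoidAll ends a₂ {a₁} ∩ connEvent ends a₂ b))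
        (prob p (avoidAll ends a₂ {a₁} ∩ (connEvent ends a₁ o ∩ connEvent ends a₁ b)) +
          prob p (avoidAll ends a₂ {a₁} ∩ (connEvent ends a₂ o ∩ connEvent ends a₁ b)) +
          prob p (avoidAll ends a₂ {a₁} ∩ (connEvent ends a₁ o ∩ connEvent ends a₂ b)) +
          prob p (avoidAll ends a₂ {a₁} ∩ (connEvent ends a₂ o ∩ connEvent ends a₂ b)))
        (gap p ends a₁ a₂ b)
        (prob p (avoidAll ends a₂ {a₁})) (prob p (PDEvent ends a₁ a₂ u)) (Do p ends o a₁ a₂ u)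
        (EQbo p ends o a₁ a₂ b) (EQb3 p ends a₁ a₂ u b) (EQb3o p ends o a₁ a₂ u b)
        (EQo p ends o a₁ a₂) (EQ3 p ends a₁ a₂ u) (EQ3o p ends o a₁ a₂ u)
        (PDb p ends a₁ a₂ u b) (PDbo p ends o a₁ a₂ u b) (gap p ends a₁ a₂ b) := by
    rw [key]
    have t1 := mul_nonneg (mul_nonneg hQ hD.le) h₀
    have t2 := mul_nonneg (mul_nonneg hD.le hD.le) h₀
    have t3 := mul_nonneg (mul_nonneg hQ hQ) h₁
    have t4 := mul_nonneg (mul_nonneg hQ hcov') hsl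
    linarith
  exact (mul_nonneg_iff_of_pos_left hQD).1 hrhs

/-- **`0 ≤ B2` at the single fractional boundary edge of a pendant `a₃`-cluster** under the same hypotheses. -/
theorem B2_nonneg_cluster (p : E → R) (hp : IsProbVec p) {ends : E → Sym2 V} {f : E}
    {o a₁ a₂ a₃ b z u : V} (hK : ∀ e ∈ fracEdges p, TouchesReach p ends a₃ e → e = f)
    (hf : ends f = s(z, u)) (hz : z ∈ pinnedReach p ends a₃) (hu : u ∉ pinnedReach p ends a₃)
    (hf1 : p f ≠ 1) (h1 : a₁ ∉ pinnedReach p ends a₃) (h2 : a₂ ∉ pinnedReach p ends a₃)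
    (ho : o ∉ pinnedReach p ends a₃) (hb : b ∉ pinnedReach p ends a₃)
    (hD : 0 < prob p (PDEvent ends a₁ a₂ u))
    (h₀ : HCov (Function.update p f 0) ends o a₁ a₂ a₃ b)
    (h₁ : HCov (Function.update p f 1) ends o a₁ a₂ a₃ b)
    (hcov : prob p (avoidAll ends a₂ {a₁}) * Do p ends o a₁ a₂ u ≤
      (prob p (avoidAll ends a₂ {a₁} ∩ connEvent ends a₁ o) +
        prob p (avoidAll ends a₂ {a₁} ∩ connEvent ends a₂ o)) * prob p (PDEvent ends a₁ a₂ u)) :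
    0 ≤ B2 p ends o a₁ a₂ a₃ b f := by
  obtain ⟨hQ0, hD0, hDo0, hEQbo0, hEQb3_0, hEQb3o0, hEQo0, hEQ3_0, hEQ3o0, hPDb0, hPDbo0, hgap0⟩ :=
    pins_zero_cluster p hK hf hz hu hf1 h1 h2 ho hb
  obtain ⟨hQ1, hD1, hDo1, hEQbo1, hEQb3_1, hEQb3o1, hEQo1, hEQ3_1, hEQ3o1, hPDb1, hPDbo1, hgap1⟩ :=
    pins_one_cluster p hK hf hz hu hf1 h1 h2 ho hb
  unfold HCov at h₀ h₁
  rw [Gc_eq_GcPoly] at h₀ h₁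
  unfold B2
  rw [hQ0, hD0, hDo0, hEQbo0, hEQb3_0, hEQb3o0, hEQo0, hEQ3_0, hEQ3o0, hPDb0, hPDbo0, hgap0] at h₀
  rw [hQ1, hD1, hDo1, hEQbo1, hEQb3_1, hEQb3o1, hEQo1, hEQ3_1, hEQ3o1, hPDb1, hPDbo1, hgap1] at h₁
  rw [hQ0, hD0, hDo0, hEQbo0, hEQb3_0, hEQb3o0, hEQo0, hEQ3_0, hEQ3o0, hPDb0, hPDbo0, hgap0, hQ1, hD1, hDo1, hEQbo1, hEQb3_1, hEQb3o1, hEQo1, hEQ3_1, hEQ3o1, hPDb1, hPDbo1, hgap1]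
  have hQ : 0 ≤ prob p (avoidAll ends a₂ {a₁}) := prob_nonneg hp _
  have hQD : 0 < prob p (avoidAll ends a₂ {a₁}) * prob p (PDEvent ends a₁ a₂ u) := by
    have hle : prob p (PDEvent ends a₁ a₂ u) ≤ prob p (avoidAll ends a₂ {a₁}) := by
      have := prob_PD_u_inter p ends a₁ a₂ u Set.univ
      simp only [Set.inter_univ] at this
      rw [this]
      linarith [prob_nonneg hp (avoidAll ends a₂ {a₁} ∩ connEvent ends a₂ u),
        prob_nonneg hp (avoidAll ends a₂ {a₁} ∩ connEvent ends a₁ u)]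
    exact mul_pos (lt_of_lt_of_le hD hle) hD
  have hsl := slack_nonneg p hp ends a₁ a₂ u b
  have key := B2Poly_pendant (prob p (avoidAll ends a₂ {a₁})) (gap p ends a₁ a₂ b)
    (EQbo p ends o a₁ a₂ b) (EQo p ends o a₁ a₂)
    (prob p (avoidAll ends a₂ {a₁} ∩ connEvent ends a₁ o) +
      prob p (avoidAll ends a₂ {a₁} ∩ connEvent ends a₂ o))
    (prob p (avoidAll ends a₂ {a₁} ∩ connEvent ends a₁ b) +
      prob p (avoidAll ends a₂ {a₁} ∩ connEvent ends a₂ b))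
    (prob p (avoidAll ends a₂ {a₁} ∩ (connEvent ends a₁ o ∩ connEvent ends a₁ b)) +
      prob p (avoidAll ends a₂ {a₁} ∩ (connEvent ends a₂ o ∩ connEvent ends a₁ b)) +
      prob p (avoidAll ends a₂ {a₁} ∩ (connEvent ends a₁ o ∩ connEvent ends a₂ b)) +
      prob p (avoidAll ends a₂ {a₁} ∩ (connEvent ends a₂ o ∩ connEvent ends a₂ b)))
    (prob p (PDEvent ends a₁ a₂ u)) (Do p ends o a₁ a₂ u) (EQb3 p ends a₁ a₂ u b)
    (EQb3o p ends o a₁ a₂ u b) (EQ3 p ends a₁ a₂ u) (EQ3o p ends o a₁ a₂ u)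
    (PDb p ends a₁ a₂ u b) (PDbo p ends o a₁ a₂ u b)
  have hcov' : 0 ≤ (prob p (avoidAll ends a₂ {a₁} ∩ connEvent ends a₁ o) +
      prob p (avoidAll ends a₂ {a₁} ∩ connEvent ends a₂ o)) * prob p (PDEvent ends a₁ a₂ u) -
      prob p (avoidAll ends a₂ {a₁}) * Do p ends o a₁ a₂ u := by linarith
  have hrhs : 0 ≤ prob p (avoidAll ends a₂ {a₁}) * prob p (PDEvent ends a₁ a₂ u) *
      B2Poly (prob p (avoidAll ends a₂ {a₁})) (prob p (avoidAll ends a₂ {a₁}))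
        (prob p (avoidAll ends a₂ {a₁} ∩ connEvent ends a₁ o) +
          prob p (avoidAll ends a₂ {a₁} ∩ connEvent ends a₂ o))
        (EQbo p ends o a₁ a₂ b) 0 0 (EQo p ends o a₁ a₂) 0 0
        (prob p (avoidAll ends a₂ {a₁} ∩ connEvent ends a₁ b) +
          prob p (avoidAll ends a₂ {a₁} ∩ connEvent ends a₂ b))
        (prob p (avoidAll ends a₂ {a₁} ∩ (connEvent ends a₁ o ∩ connEvent ends a₁ b)) +
          prob p (avoidAll ends a₂ {a₁} ∩ (connEvent ends a₂ o ∩ connEvent ends a₁ b)) +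
          prob p (avoidAll ends a₂ {a₁} ∩ (connEvent ends a₁ o ∩ connEvent ends a₂ b)) +
          prob p (avoidAll ends a₂ {a₁} ∩ (connEvent ends a₂ o ∩ connEvent ends a₂ b)))
        (gap p ends a₁ a₂ b)
        (prob p (avoidAll ends a₂ {a₁})) (prob p (PDEvent ends a₁ a₂ u)) (Do p ends o a₁ a₂ u)
        (EQbo p ends o a₁ a₂ b) (EQb3 p ends a₁ a₂ u b) (EQb3o p ends o a₁ a₂ u b)
        (EQo p ends o a₁ a₂) (EQ3 p ends a₁ a₂ u) (EQ3o p ends o a₁ a₂ u)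
        (PDb p ends a₁ a₂ u b) (PDbo p ends o a₁ a₂ u b) (gap p ends a₁ a₂ b) := by
    rw [key]
    have t1 := mul_nonneg (mul_nonneg hQ hD.le) h₁
    have t2 := mul_nonneg (mul_nonneg hD.le hD.le) h₀
    have t3 := mul_nonneg (mul_nonneg hQ hQ) h₁
    have t4 := mul_nonneg (mul_nonneg hQ hcov') hsl
    linarith
  exact (mul_nonneg_iff_of_pos_left hQD).1 hrhs

/-- **The pendant-cluster closure of (HCOV)**: at the single fractional boundary edge `f` of a mark-free
pendant `a₃`-cluster, (HCOV) at `p[f↦0]` and at `p[f↦1]`, `P(PD_u) > 0` and `Cov_ν(U_o, U_u) ≥ 0` give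
(HCOV) at `p` (through `EdgeLine.HCov_of_update_zero_of_bern`). -/
theorem HCov_cluster_of_cov_nonneg (p : E → R) (hp : IsProbVec p) {ends : E → Sym2 V} {f : E}
    {o a₁ a₂ a₃ b z u : V} (hK : ∀ e ∈ fracEdges p, TouchesReach p ends a₃ e → e = f)
    (hf : ends f = s(z, u)) (hz : z ∈ pinnedReach p ends a₃) (hu : u ∉ pinnedReach p ends a₃)
    (hf1 : p f ≠ 1) (h1 : a₁ ∉ pinnedReach p ends a₃) (h2 : a₂ ∉ pinnedReach p ends a₃)
    (ho : o ∉ pinnedReach p ends a₃) (hb : b ∉ pinnedReach p ends a₃)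
    (hD : 0 < prob p (PDEvent ends a₁ a₂ u))
    (h₀ : HCov (Function.update p f 0) ends o a₁ a₂ a₃ b)
    (h₁ : HCov (Function.update p f 1) ends o a₁ a₂ a₃ b)
    (hcov : prob p (avoidAll ends a₂ {a₁}) * Do p ends o a₁ a₂ u ≤
      (prob p (avoidAll ends a₂ {a₁} ∩ connEvent ends a₁ o) +
        prob p (avoidAll ends a₂ {a₁} ∩ connEvent ends a₂ o)) * prob p (PDEvent ends a₁ a₂ u)) :
    HCov p ends o a₁ a₂ a₃ b :=
  HCov_of_update_zero_of_bern p hp ends o a₁ a₂ a₃ b f h₀ h₁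
    (B1_nonneg_cluster p hp hK hf hz hu hf1 h1 h2 ho hb hD h₀ h₁ hcov)
    (B2_nonneg_cluster p hp hK hf hz hu hf1 h1 h2 ho hb hD h₀ h₁ hcov)

/-- **A pendant-PA edge**: `e` is the only fractional edge touching the reach of `a₃`, it joins the reach
to an outer vertex `u` with `P(PD_u) > 0`, and `Cov_ν(U_o, U_u) ≥ 0` (cleared). -/
def PendantPA (q : E → R) (ends : E → Sym2 V) (o a₁ a₂ a₃ : V) (e : E) : Prop :=
  (∀ e' ∈ fracEdges q, TouchesReach q ends a₃ e' → e' = e) ∧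
    ∃ z u, ends e = s(z, u) ∧ z ∈ pinnedReach q ends a₃ ∧ u ∉ pinnedReach q ends a₃ ∧
      0 < prob q (PDEvent ends a₁ a₂ u) ∧
      prob q (avoidAll ends a₂ {a₁}) * Do q ends o a₁ a₂ u ≤
        (prob q (avoidAll ends a₂ {a₁} ∩ connEvent ends a₁ o) +
          prob q (avoidAll ends a₂ {a₁} ∩ connEvent ends a₂ o)) * prob q (PDEvent ends a₁ a₂ u)

/-- **(HCOV) from the one-edge Bernstein positivity at the fractional non-root, NON-pendant-PA edges
touching a mark-free reach of `a₃`**: the induction of `CPolarA3.HCov_of_bern_a3_free` with the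
pendant-PA edges taken by `HCov_cluster_of_cov_nonneg`. -/
theorem HCov_of_bern_a3_nonpendant (ends : E → Sym2 V) (o a₁ a₂ a₃ b : V)
    (hB : ∀ q : E → R, IsProbVec q → MarkFree q ends o a₁ a₂ a₃ b → ∀ e, q e ≠ 0 → q e ≠ 1 →
      TouchesReach q ends a₃ e → ¬ RootEdge.IsRootEdge ends a₁ a₂ a₃ e →
      ¬ PendantPA q ends o a₁ a₂ a₃ e →
      0 ≤ B1 q ends o a₁ a₂ a₃ b e ∧ 0 ≤ B2 q ends o a₁ a₂ a₃ b e)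
    (p : E → R) (hp : IsProbVec p) : HCov p ends o a₁ a₂ a₃ b := by
  generalize hn : (fracEdges p).card = n
  induction n using Nat.strong_induction_on generalizing p with
  | _ n ih =>
    by_cases hm : a₁ ∈ pinnedReach p ends a₃ ∨ a₂ ∈ pinnedReach p ends a₃ ∨
        o ∈ pinnedReach p ends a₃ ∨ b ∈ pinnedReach p ends a₃
    · exact HCov_of_mark_mem_pinnedReach hp hm
    · have hfree : MarkFree p ends o a₁ a₂ a₃ b := by
        simp only [not_or] at hm
        exact ⟨hm.1, hm.2.1, hm.2.2.1, hm.2.2.2⟩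
      by_cases h : ∃ e ∈ fracEdges p, TouchesReach p ends a₃ e
      · obtain ⟨e, he, ht⟩ := h
        have hlt : ((fracEdges p).erase e).card < n := by
          rw [← hn]; exact Finset.card_erase_lt_of_mem he
        have hp₀ : IsProbVec (Function.update p e 0) := hp.update e le_rfl zero_le_one
        have hp₁ : IsProbVec (Function.update p e 1) := hp.update e zero_le_one le_rfl
        have h₀ : HCov (Function.update p e 0) ends o a₁ a₂ a₃ b :=
          ih _ hlt (Function.update p e 0) hp₀ (by rw [fracEdges_update p e 0 (Or.inl rfl)])
        have h₁ : HCov (Function.update p e 1) ends o a₁ a₂ a₃ b :=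
          ih _ hlt (Function.update p e 1) hp₁ (by rw [fracEdges_update p e 1 (Or.inr rfl)])
        have hfe : p e ≠ 0 ∧ p e ≠ 1 := by simpa [fracEdges] using he
        by_cases hr : RootEdge.IsRootEdge ends a₁ a₂ a₃ e
        · exact HCov_of_update_zero_of_bern p hp ends o a₁ a₂ a₃ b e h₀ h₁
            (RootEdge.B1_nonneg_of_isRootEdge p hp ends o a₁ a₂ a₃ b e hr h₀)
            (RootEdge.B2_nonneg_of_isRootEdge p hp ends o a₁ a₂ a₃ b e hr)
        · by_cases hpa : PendantPA p ends o a₁ a₂ a₃ e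
          · obtain ⟨hK, z, u, hends, hz, hu, hD, hcov⟩ := hpa
            exact HCov_cluster_of_cov_nonneg p hp hK hends hz hu hfe.2 hfree.1 hfree.2.1
              hfree.2.2.1 hfree.2.2.2 hD h₀ h₁ hcov
          · exact HCov_of_update_zero_of_bern p hp ends o a₁ a₂ a₃ b e h₀ h₁
              (hB p hp hfree e hfe.1 hfe.2 ht hr hpa).1 (hB p hp hfree e hfe.1 hfe.2 ht hr hpa).2
      · simp only [not_exists, not_and] at h
        exact HCov_of_reach_pinned p hp ends o a₁ a₂ a₃ b h

end Main

section Closure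

variable (R : Type*) [Field R] [LinearOrder R] [IsStrictOrderedRing R]

/-- **Row 2′CPOLAR at the non-root, non-pendant-PA edges of a mark-free `a₃`-cluster**: the binders of
`CPolarA3Free_all` with the pendant-PA edges (the single fractional boundary edge of the reach, joining
it to a vertex `u` with `P(PD_u) > 0` and `Cov_ν(U_o, U_u) ≥ 0`) excluded — they are theorems. -/
def CPolarA3NP_all : Prop :=
  ∀ (V E : Type) [Fintype V] [DecidableEq V] [Fintype E] [DecidableEq E]
    (ends : E → Sym2 V) (p : E → R), IsProbVec p →
    ∀ o a₁ a₂ a₃ b : V, a₁ ≠ a₂ → a₁ ≠ a₃ → a₂ ≠ a₃ → o ≠ a₁ → o ≠ a₂ → o ≠ a₃ → o ≠ b →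
      b ≠ a₁ → b ≠ a₂ → b ≠ a₃ → MarkFree p ends o a₁ a₂ a₃ b →
      ∀ e, p e ≠ 0 → p e ≠ 1 → TouchesReach p ends a₃ e → ¬ RootEdge.IsRootEdge ends a₁ a₂ a₃ e →
        ¬ PendantPA p ends o a₁ a₂ a₃ e →
        0 ≤ EdgeLine.B1 p ends o a₁ a₂ a₃ b e ∧ 0 ≤ EdgeLine.B2 p ends o a₁ a₂ a₃ b e

omit [IsStrictOrderedRing R] in
/-- `CPolarA3NP_all` is weaker than `CPolarA3Free_all`. -/
theorem cpolarA3NP_all_of_cpolarA3Free_all (h : CPolarA3Free_all R) : CPolarA3NP_all R := by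
  intro V E _ _ _ _ ends p hp o a₁ a₂ a₃ b h1 h2 h3 h4 h5 h6 h7 h8 h9 h10 hfree e h0 h1' ht hr _
  exact h V E ends p hp o a₁ a₂ a₃ b h1 h2 h3 h4 h5 h6 h7 h8 h9 h10 hfree e h0 h1' ht hr

/-- **Row 2′CPOLAR at the non-root, non-pendant-PA edges of a mark-free `a₃`-cluster implies the crux.** -/
theorem HCov_all_of_cpolarA3NP_all (h : CPolarA3NP_all R) : HCov_all R := by
  intro V E _ _ _ _ ends p hp o a₁ a₂ a₃ b h1 h2 h3 h4 h5 h6 h7 h8 h9 h10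
  exact HCov_of_bern_a3_nonpendant ends o a₁ a₂ a₃ b
    (fun q hq hfree e h0 h1' ht hr hpa =>
      h V E ends q hq o a₁ a₂ a₃ b h1 h2 h3 h4 h5 h6 h7 h8 h9 h10 hfree e h0 h1' ht hr hpa) p hp

end Closure

end PendantCluster

end Summit.Ventures.PercRepro2
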